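import Mathlib.Algebra.Lie.SkewAdjoint
import Mathlib.LinearAlgebra.Trace
import Mathlib.LinearAlgebra.BilinearForm.Properties
import Mathlib.LinearAlgebra.Dimension.Finrank
import HarnessLib

/-!
# The symplectic Lie algebra as symmetric squares: `𝔰𝔭(V, ω) = span {s_{xy}}`, `s_{xy} = ω(·,x)y + ω(·,y)x`
(Fulton–Harris §16.1: `Sym² V ≅ 𝔰𝔭(V)`; the bracket, conjugation, trace and spanning formulas)

For an alternating form `ω` on `V` and `x, y ∈ V` put `s_{xy}(z) := ω(z, x) y + ω(z, y) x` (`symSq ω x y`). Then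
* `symSq_mem_skewAdjointLieSubalgebra`: `s_{xy} ∈ 𝔰𝔭(V, ω)` (= Mathlib's `skewAdjointLieSubalgebra ω`);
* `symSq_comm`, `symSq_add_left`, `symSq_smul_left`, `symSq_apply_self_left` (`s_{xy} x = ω(x,y) x`);
* **`symSq_commutator`**: `s_{ab} s_{cd} − s_{cd} s_{ab} = ω(d,a) s_{bc} + ω(d,b) s_{ac} + ω(c,a) s_{bd} + ω(c,b) s_{ad}`
  (the multiplication table of `Sym² V ≅ 𝔰𝔭(V)`), and `lie_symSq_symSq` (the same for the commutator bracket);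
* `conj_symSq`: `g s_{xy} g⁻¹ = s_{g x, g y}` for an `ω`-isometry `g`;
* `trace_symSq_mul_symSq`: `tr(s_{ab} s_{cd}) = 2 (ω(d,a) ω(b,c) + ω(d,b) ω(a,c))`;
* **`mem_span_symSq_of_mem_skewAdjointLieSubalgebra`**: for `ω` non-degenerate and `2 ≠ 0`, every `X ∈ 𝔰𝔭(V, ω)` is
  `X = ½ Σᵢ s_{bᵢ, X dᵢ}` for any basis `b` with `ω`-dual basis `d` — so `𝔰𝔭(V, ω)` is spanned by the `s_{xy}`
  (`skewAdjointLieSubalgebra_le_span_symSq`, and `= span` as submodules, `span_symSq_eq`).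
Pure linear algebra over any field (`2 ≠ 0` only for the spanning). Typed for the Hodge cell's big-monodromy lemma BL (crux K1Q:
the `Ad γ`-grading of `𝔰𝔭(M)` for a bireflection `γ` and the elements `s_{u v₊}`, `[s_{u v₊}, s_{w v₋}]`).
-/

namespace Literature.Algebra.Lie

-- Mathlib's own non-instance `def` for the commutator bracket on an associative ring, enabled LOCALLY exactly as
-- `Mathlib.Algebra.Lie.SkewAdjoint` and the tree's `KatzRecognitionTheorems` do.
attribute [local instance 100] LieRing.ofAssociativeRing

namespace SymplecticSymmetricSquares

open Module
open LinearMap (BilinForm)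

variable {K : Type*} [Field K] {V : Type*} [AddCommGroup V] [Module K V]

/-- The symmetric square element `s_{xy} : z ↦ ω(z, x) y + ω(z, y) x` of `End(V)` (for alternating `ω` an element of
`𝔰𝔭(V, ω)`; under `Sym² V ≅ 𝔰𝔭(V)` it is the image of `x · y`). [cite: FultonHarris1991, §16.1] -/
def symSq (ω : BilinForm K V) (x y : V) : Module.End K V :=
  (ω.flip x).smulRight y + (ω.flip y).smulRight x

/-- `s_{xy}(z) = ω(z,x) y + ω(z,y) x`. [cite: FultonHarris1991, §16.1] -/
@[simp]
theorem symSq_apply (ω : BilinForm K V) (x y z : V) : symSq ω x y z = ω z x • y + ω z y • x := by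
  simp [symSq]

/-- `s_{xy} = s_{yx}`. [cite: FultonHarris1991, §16.1] -/
theorem symSq_comm (ω : BilinForm K V) (x y : V) : symSq ω x y = symSq ω y x := by
  ext z; simp only [symSq_apply]; rw [add_comm]

/-- Additivity in the first slot. [cite: FultonHarris1991, §16.1] -/
theorem symSq_add_left (ω : BilinForm K V) (x x' y : V) : symSq ω (x + x') y = symSq ω x y + symSq ω x' y := by
  ext z; simp only [symSq_apply, map_add, LinearMap.add_apply, add_smul, smul_add]; abel

/-- Homogeneity in the first slot. [cite: FultonHarris1991, §16.1] -/
theorem symSq_smul_left (ω : BilinForm K V) (c : K) (x y : V) : symSq ω (c • x) y = c • symSq ω x y := by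
  ext z; simp only [symSq_apply, map_smul, smul_eq_mul, LinearMap.smul_apply, smul_add, smul_smul, mul_comm c]

/-- `s_{xy} = 0` if `x = 0`. [cite: FultonHarris1991, §16.1] -/
@[simp]
theorem symSq_zero_left (ω : BilinForm K V) (y : V) : symSq ω 0 y = 0 := by
  ext z; simp

/-- `s_{xy}(x) = ω(x,y) x` for alternating `ω`. [cite: FultonHarris1991, §16.1] -/
theorem symSq_apply_self_left {ω : BilinForm K V} (hω : ω.IsAlt) (x y : V) : symSq ω x y x = ω x y • x := by
  rw [symSq_apply, hω x, zero_smul, zero_add]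

/-- `s_{xy}(z) = 0` for `z` `ω`-orthogonal to `x` and `y`. [cite: FultonHarris1991, §16.1] -/
theorem symSq_apply_of_orthogonal (ω : BilinForm K V) {x y z : V} (hx : ω z x = 0) (hy : ω z y = 0) :
    symSq ω x y z = 0 := by
  rw [symSq_apply, hx, hy, zero_smul, zero_smul, add_zero]

/-- **`s_{xy} ∈ 𝔰𝔭(V, ω)`** for alternating `ω`: `ω(s z, w) + ω(z, s w) = 0`. [cite: FultonHarris1991, §16.1] -/
theorem symSq_mem_skewAdjointLieSubalgebra {ω : BilinForm K V} (hω : ω.IsAlt) (x y : V) :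
    symSq ω x y ∈ skewAdjointLieSubalgebra ω := by
  show symSq ω x y ∈ ω.skewAdjointSubmodule
  rw [LinearMap.mem_skewAdjointSubmodule]
  intro z w
  rw [Pi.neg_apply, map_neg]
  simp only [symSq_apply, map_add, map_smul, LinearMap.add_apply, LinearMap.smul_apply, smul_eq_mul]
  rw [← hω.neg_eq w y, ← hω.neg_eq w x]
  ring

/-- **The multiplication table of `Sym² V ≅ 𝔰𝔭(V)`**: for alternating `ω`,
`s_{ab} s_{cd} − s_{cd} s_{ab} = ω(d,a) s_{bc} + ω(d,b) s_{ac} + ω(c,a) s_{bd} + ω(c,b) s_{ad}`.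
[cite: FultonHarris1991, §16.1] -/
theorem symSq_commutator {ω : BilinForm K V} (hω : ω.IsAlt) (a b c d : V) :
    symSq ω a b * symSq ω c d - symSq ω c d * symSq ω a b =
      ω d a • symSq ω b c + ω d b • symSq ω a c + ω c a • symSq ω b d + ω c b • symSq ω a d := by
  ext z
  simp only [LinearMap.sub_apply, Module.End.mul_apply, symSq_apply, map_add, map_smul, LinearMap.add_apply,
    LinearMap.smul_apply, smul_add, smul_smul]
  rw [← hω.neg_eq c b, ← hω.neg_eq d b, ← hω.neg_eq c a, ← hω.neg_eq d a]
  module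

/-- The same table for the commutator Lie bracket of `End(V)`. [cite: FultonHarris1991, §16.1] -/
theorem lie_symSq_symSq {ω : BilinForm K V} (hω : ω.IsAlt) (a b c d : V) :
    ⁅symSq ω a b, symSq ω c d⁆ =
      ω d a • symSq ω b c + ω d b • symSq ω a c + ω c a • symSq ω b d + ω c b • symSq ω a d := by
  rw [LieRing.of_associative_ring_bracket, symSq_commutator hω]

/-- **Conjugation by an isometry**: `g s_{xy} g⁻¹ = s_{g x, g y}` for `g` preserving `ω`. [cite: FultonHarris1991, §16.1] -/
theorem conj_symSq (ω : BilinForm K V) {g : V ≃ₗ[K] V} (hg : ∀ x y, ω (g x) (g y) = ω x y) (x y : V) :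
    (g : Module.End K V) * symSq ω x y * (g.symm : Module.End K V) = symSq ω (g x) (g y) := by
  ext z
  simp only [Module.End.mul_apply, LinearEquiv.coe_coe, symSq_apply, map_add, map_smul]
  have h1 : ω (g.symm z) x = ω z (g x) := by rw [← hg (g.symm z) x, LinearEquiv.apply_symm_apply]
  have h2 : ω (g.symm z) y = ω z (g y) := by rw [← hg (g.symm z) y, LinearEquiv.apply_symm_apply]
  rw [h1, h2]

section Trace

variable [FiniteDimensional K V]

/-- `tr(z ↦ ω(z, x) y) = ω(y, x)`. [cite: FultonHarris1991, §16.1] -/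
theorem trace_smulRight_flip (ω : BilinForm K V) (x y : V) :
    LinearMap.trace K V ((ω.flip x).smulRight y) = ω y x := by
  rw [LinearMap.trace_smulRight]; rfl

/-- **Trace form on symmetric squares**: `tr(s_{ab} s_{cd}) = 2 (ω(d,a) ω(b,c) + ω(d,b) ω(a,c))` for alternating `ω`.
[cite: FultonHarris1991, §16.1] -/
theorem trace_symSq_mul_symSq {ω : BilinForm K V} (hω : ω.IsAlt) (a b c d : V) :
    LinearMap.trace K V (symSq ω a b * symSq ω c d) = 2 * (ω d a * ω b c + ω d b * ω a c) := by
  have hprod : symSq ω a b * symSq ω c d =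
      (ω.flip c).smulRight (ω d a • b + ω d b • a) + (ω.flip d).smulRight (ω c a • b + ω c b • a) := by
    have hflip : ∀ x z : V, ω.flip x z = ω z x := fun _ _ => rfl
    ext z
    simp only [Module.End.mul_apply, symSq_apply, map_add, map_smul, LinearMap.add_apply, LinearMap.smulRight_apply,
      hflip, smul_add, smul_smul]
  rw [hprod, map_add, trace_smulRight_flip, trace_smulRight_flip]
  simp only [map_add, map_smul, LinearMap.add_apply, LinearMap.smul_apply, smul_eq_mul]
  rw [← hω.neg_eq a c, ← hω.neg_eq d b, ← hω.neg_eq b c, ← hω.neg_eq d a]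
  ring

end Trace

section Span

variable [FiniteDimensional K V]

omit [FiniteDimensional K V] in
/-- Expansion of a vector in a basis `b` through the `ω`-dual basis `d` (`ω(dᵢ, bⱼ) = δᵢⱼ`): `w = Σᵢ ω(dᵢ, w) bᵢ`.
[cite: FultonHarris1991, §16.1] -/
theorem sum_apply_dualBasis_smul {ω : BilinForm K V} (hω : ω.Nondegenerate) {ι : Type*} [Fintype ι] [DecidableEq ι]
    (b : Basis ι K V) (w : V) : ∑ i, ω (ω.dualBasis hω b i) w • b i = w := by
  have hcoef : ∀ i, ω (ω.dualBasis hω b i) w = b.repr w i := by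
    intro i
    conv_lhs => rw [← b.sum_repr w]
    simp only [map_sum, map_smul, smul_eq_mul, LinearMap.BilinForm.apply_dualBasis_left, mul_ite, mul_one, mul_zero,
      Finset.sum_ite_eq', Finset.mem_univ, if_true]
  simp only [hcoef, b.sum_repr]

omit [FiniteDimensional K V] in
/-- Expansion of a vector in the `ω`-dual basis: `w = Σᵢ ω(w, bᵢ) dᵢ`. [cite: FultonHarris1991, §16.1] -/
theorem sum_apply_smul_dualBasis {ω : BilinForm K V} (hω : ω.Nondegenerate) {ι : Type*} [Fintype ι] [DecidableEq ι]
    (b : Basis ι K V) (w : V) : ∑ i, ω w (b i) • ω.dualBasis hω b i = w := by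
  conv_rhs => rw [← (ω.dualBasis hω b).sum_repr w]
  simp only [LinearMap.BilinForm.dualBasis_repr_apply]

omit [FiniteDimensional K V] in
/-- **`X = ½ Σᵢ s_{bᵢ, X dᵢ}` for `X ∈ 𝔰𝔭(V, ω)`** (`b` any basis, `d` its `ω`-dual basis, `ω` non-degenerate alternating):
precisely, `Σᵢ s_{bᵢ, X dᵢ} = 2 X`. [cite: FultonHarris1991, §16.1] -/
theorem sum_symSq_basis_dualBasis {ω : BilinForm K V} (hω : ω.Nondegenerate) (halt : ω.IsAlt) {ι : Type*} [Fintype ι]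
    [DecidableEq ι] (b : Basis ι K V) {X : Module.End K V} (hX : X ∈ skewAdjointLieSubalgebra ω) :
    ∑ i, symSq ω (b i) (X (ω.dualBasis hω b i)) = (2 : K) • X := by
  have hskew : ∀ z w, ω z (X w) = -ω (X z) w := fun z w => by
    have hX' : X ∈ ω.skewAdjointSubmodule := hX
    rw [LinearMap.mem_skewAdjointSubmodule] at hX'
    have h := hX' z w
    rw [Pi.neg_apply, map_neg] at h
    linear_combination h
  ext z
  simp only [LinearMap.sum_apply, symSq_apply, LinearMap.smul_apply]
  rw [two_smul]
  rw [Finset.sum_add_distrib]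
  congr 1
  · -- `Σᵢ ω(z, bᵢ) X dᵢ = X (Σᵢ ω(z, bᵢ) dᵢ) = X z`
    have := congrArg X (sum_apply_smul_dualBasis hω b z)
    simpa only [map_sum, map_smul] using this
  · -- `Σᵢ ω(z, X dᵢ) bᵢ = Σᵢ ω(dᵢ, X z) bᵢ = X z`
    have h : ∀ i, ω z (X (ω.dualBasis hω b i)) = ω (ω.dualBasis hω b i) (X z) := fun i => by
      rw [hskew, halt.neg_eq]
    simp only [h, sum_apply_dualBasis_smul hω b (X z)]

/-- **`𝔰𝔭(V, ω)` is spanned by the symmetric squares** (`ω` non-degenerate alternating, `2 ≠ 0` in `K`): every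
`X ∈ skewAdjointLieSubalgebra ω` lies in `span {s_{xy}}`. [cite: FultonHarris1991, §16.1] -/
theorem mem_span_symSq_of_mem_skewAdjointLieSubalgebra {ω : BilinForm K V} (hω : ω.Nondegenerate) (halt : ω.IsAlt)
    (h2 : (2 : K) ≠ 0) {X : Module.End K V} (hX : X ∈ skewAdjointLieSubalgebra ω) :
    X ∈ Submodule.span K (Set.range fun p : V × V => symSq ω p.1 p.2) := by
  classical
  let b := Module.finBasis K V
  have hsum := sum_symSq_basis_dualBasis hω halt b hX
  have hX2 : X = (2 : K)⁻¹ • ∑ i, symSq ω (b i) (X (ω.dualBasis hω b i)) := by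
    rw [hsum, smul_smul, inv_mul_cancel₀ h2, one_smul]
  rw [hX2]
  refine Submodule.smul_mem _ _ (Submodule.sum_mem _ fun i _ => Submodule.subset_span ⟨(b i, X (ω.dualBasis hω b i)), rfl⟩)

/-- `𝔰𝔭(V, ω) ≤ span {s_{xy}}` as submodules of `End(V)`. [cite: FultonHarris1991, §16.1] -/
theorem skewAdjointLieSubalgebra_le_span_symSq {ω : BilinForm K V} (hω : ω.Nondegenerate) (halt : ω.IsAlt)
    (h2 : (2 : K) ≠ 0) :
    (skewAdjointLieSubalgebra ω).toSubmodule ≤ Submodule.span K (Set.range fun p : V × V => symSq ω p.1 p.2) :=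
  fun _ hX => mem_span_symSq_of_mem_skewAdjointLieSubalgebra hω halt h2 hX

/-- **`𝔰𝔭(V, ω) = span {s_{xy}}`** (`ω` non-degenerate alternating, `2 ≠ 0`). [cite: FultonHarris1991, §16.1] -/
theorem span_symSq_eq {ω : BilinForm K V} (hω : ω.Nondegenerate) (halt : ω.IsAlt) (h2 : (2 : K) ≠ 0) :
    Submodule.span K (Set.range fun p : V × V => symSq ω p.1 p.2) = (skewAdjointLieSubalgebra ω).toSubmodule := by
  refine le_antisymm (Submodule.span_le.2 ?_) (skewAdjointLieSubalgebra_le_span_symSq hω halt h2)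
  rintro _ ⟨p, rfl⟩
  exact symSq_mem_skewAdjointLieSubalgebra halt p.1 p.2

end Span

end SymplecticSymmetricSquares

end Literature.Algebra.Lie
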